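import Literature.NumberTheory.ComplexMultiplication.DegenerateOcticCMTypesSexticReflex
import Literature.AlgebraicGeometry.ComplexMultiplication.EndomorphismFieldNondegenerateType
import Literature.NumberTheory.ComplexMultiplication.ShimuraTaniyamaHecke
import Summits.HodgeConjecture.HodgeConjecture.Theorems.Ring2ClassTargets
import HarnessLib

/-!
# Octic CM fields inside a Galois CM field of degree prime to `3`: ALL abelian fourfolds with an action of the field
# are stably nondegenerate

COR-CM (cell `pub-hodgecm2`), binder seat b04 (gen 21), count-neutral claim OCTIC-PRIME-TO-THREE-ALLTYPES.  KERNEL ONLY: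
theorems; no definition, no named fact, no `sorry`.  `HC_CM` is neither used nor claimed.

Dodson's §3.3.2 (tree: lit `DegenerateOcticCMTypesSexticReflex.three_dvd_card_gal_of_not_isNondegenerate` — a DEGENERATE
primitive CM type of an octic CM field `K` embedded in a Galois CM field `L` forces `3 ∣ |Gal(L/ℚ)|`, its six Galois
translates forming one orbit) makes EVERY octic CM field that embeds in a Galois CM field of degree prime to `3` GOOD —
with NO hypothesis on `K` itself (not Galois, `|Aut(K)| = 2` allowed: e.g. `K = K⁺(√-α)` with `K⁺` a `D₄`- or
`C₄`-quartic and Galois closure of `2`-power degree; the degenerate Mumford fourfolds have closure `ℤ₂ × A₄`/`ℤ₂ × S₄`).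
With lit-hodgefound's primitive-core engine for non-simple fourfolds (`isStablyNondegenerate_of_not_isSimple`, core
of dimension `≤ 2`): **every abelian FOURFOLD `X` with `K ↪ End⁰(X)` is stably nondegenerate** — gen 13's octic theorem
(`|Aut K| > 2`) and gen 21 part V extended to the whole prime-to-`3` locus.

* `isNondegenerate_of_isPrimitive_octic_of_embedding` — `K ↪ L`, `L` Galois CM, `3 ∤ [L:ℚ]` ⟹ primitive types of `K`
  nondegenerate; **`isStablyNondegenerate_octic_of_embedding`** — all fourfolds; HC corollaries; realisation form; HCOnClass.

## References

* [Dodson1984] B. Dodson, *The structure of Galois groups of CM-fields*, Trans. AMS 283 (1984), §3.3.2 Theorem (p. 16).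
* [Ribet1980] K. A. Ribet, Mém. SMF 2 (1980), §3 Examples (3.7).
* [Gordon1999HodgeAVSurvey] B. B. Gordon, *A survey of the Hodge conjecture for abelian varieties*, 5.13, Thm. 6.3–6.4.
* [Shimura1998] G. Shimura, *Abelian Varieties with Complex Multiplication and Modular Functions*, §5.1 Prop. 3, §8.2
  Prop. 26.
-/

noncomputable section

open CategoryTheory CategoryTheory.Limits NumberField

namespace Summit.HodgeConjecture.CorCM.OcticPrimeToThreeAllTypes

open Literature.NumberTheory.ComplexMultiplication
open Literature.AlgebraicGeometry Literature.AlgebraicGeometry.Motives Literature.AlgebraicGeometry.HodgeTheory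
open Literature.AlgebraicGeometry.Motives.AbelianVariety
open Literature.AlgebraicGeometry.ComplexMultiplication
open Literature.AlgebraicGeometry.Pohlmann1968
open Summit.HodgeConjecture.HodgeConjecture.Ring2.ClassTargets

variable {K : Type} [Field K] [NumberField K] [IsCMField K]
variable {L : Type} [Field L] [NumberField L] [IsCMField L] [IsGalois ℚ L]

/-- **Octic CM fields embedded in a Galois CM field of degree prime to `3` are GOOD**: every primitive CM type is
nondegenerate (a degenerate one would force `3 ∣ |Gal(L/ℚ)|`, Dodson §3.3.2). [cite: Dodson1984, §3.3.2 Theorem (p. 16)] -/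
theorem isNondegenerate_of_isPrimitive_octic_of_embedding (h8 : Module.finrank ℚ K = 8) (j : K →ₐ[ℚ] L)
    (h3 : ¬ 3 ∣ Module.finrank ℚ L) (Φ : CMType K) (φ₀ : K →+* ℂ) (hprim : IsPrimitive (ℂ ≃+* ℂ) Φ.1 φ₀) :
    IsNondegenerate Φ := by
  by_contra hdeg
  obtain ⟨ι⟩ := (inferInstance : Nonempty (L →+* ℂ))
  have h := three_dvd_card_gal_of_not_isNondegenerate h8 j ι Φ φ₀ hprim hdeg
  rw [IsGalois.card_aut_eq_finrank] at h
  exact h3 h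

/-- **THEOREM (ALL fourfolds).  `K` an octic CM field embedded in a Galois CM field `L` with `3 ∤ [L:ℚ]`: EVERY complex
abelian variety `X` with `φ : K →+* End⁰(X)` and `[K:ℚ] = 2 dim X` (an abelian fourfold) is STABLY NONDEGENERATE** —
simple ones by Dodson (THE type is primitive, Shimura §8.2 Prop. 26), non-simple ones by the primitive core of dimension
`≤ 2` (Ribet). No hypothesis on `Aut(K)`; UNCONDITIONAL. [cite: Dodson1984, §3.3.2 Theorem (p. 16)]
[cite: Ribet1980, §3 Examples (3.7)] [cite: Gordon1999HodgeAVSurvey, Thm. 6.3–6.4] -/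
theorem isStablyNondegenerate_octic_of_embedding (h8 : Module.finrank ℚ K = 8) (j : K →ₐ[ℚ] L)
    (h3 : ¬ 3 ∣ Module.finrank ℚ L) {X : AbelianVariety ℂ} (φ : K →+* X.endAlgebra)
    (hX : Module.finrank ℚ K = 2 * X.dim) : IsStablyNondegenerate X := by
  by_cases hs : X.IsSimple
  · obtain ⟨φ₀⟩ := (inferInstance : Nonempty (K →+* ℂ))
    have hprim := (isPrimitive_ringEquiv_complex_iff _ φ₀).2
      ((EndFieldFullDegree.isSimple_iff_primitive_cmTypeOfPair φ hX).1 hs)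
    exact EndFieldFullDegree.isStablyNondegenerate_of_isNondegenerate_cmTypeOfPair φ hX
      (isNondegenerate_of_isPrimitive_octic_of_embedding h8 j h3 _ φ₀ hprim)
  · refine EndFieldFullDegree.isStablyNondegenerate_of_not_isSimple φ hX hs fun d hd hlt => Or.inl ?_
    have h4 : X.dim = 4 := by omega
    rw [h4] at hd hlt
    have : d ≤ 4 := Nat.le_of_dvd (by norm_num) hd
    interval_cases d <;> simp_all

/-- **The Hodge conjecture for everything isogenous to a power of such a fourfold.** [cite: Gordon1999HodgeAVSurvey, Thm. 6.3–6.4]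
[cite: vanGeemen1994HodgeAV, Lemma 3.7] -/
theorem hodgeConjectureFor_of_isIsogenous_powSucc_octic_of_embedding (h8 : Module.finrank ℚ K = 8) (j : K →ₐ[ℚ] L)
    (h3 : ¬ 3 ∣ Module.finrank ℚ L) {X : AbelianVariety ℂ} (φ : K →+* X.endAlgebra)
    (hX : Module.finrank ℚ K = 2 * X.dim) {B : AbelianVariety ℂ} {N : ℕ} (h : IsIsogenous B (X.powSucc N)) :
    HodgeConjectureFor B.dim B.X :=
  (isStablyNondegenerate_octic_of_embedding h8 j h3 φ hX).hodgeConjectureFor_of_isIsogenous_powSucc h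

variable {Φ : CMType K} {A : AbelianVariety ℂ} {ι : 𝓞 K →+* End A} {θ : K →+* Module.End ℂ (complexBetti A.X 1)}

/-- **Realisation form: the Hodge conjecture for every power of EVERY abelian variety with CM by such an octic `K`.**
[cite: Dodson1984, §3.3.2 Theorem (p. 16)] [cite: Gordon1999HodgeAVSurvey, Thm. 6.4] -/
theorem hodgeConjectureFor_pow_octic_of_embedding (h8 : Module.finrank ℚ K = 8) (j : K →ₐ[ℚ] L)
    (h3 : ¬ 3 ∣ Module.finrank ℚ L) (hA : IsCMTypeRealisation Φ A ι θ) (N : ℕ) :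
    HodgeConjectureFor (⨁ fun _ : Fin N => A).dim (⨁ fun _ : Fin N => A).X := by
  obtain ⟨i, -⟩ := exists_ringHom_endAlgebra ι
  exact hodgeConjectureFor_of_isDivisorGenerated _
    ((isStablyNondegenerate_iff_forall_isDivisorGenerated_biproduct A).1
      (isStablyNondegenerate_octic_of_embedding h8 j h3 i (finrank_eq_two_mul_dim_of_isCMTypeRealisation hA)) N)

/-- **HC on the class «isogenous to a power of an abelian fourfold `X` with an octic CM field `K ↪ End⁰(X)` that embeds
in a Galois CM field of degree prime to `3`»** — UNCONDITIONAL, no simplicity, no hypothesis on `Aut(K)`.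
[cite: Dodson1984, §3.3.2 Theorem (p. 16)] [cite: Gordon1999HodgeAVSurvey, Thm. 6.3–6.4] -/
theorem hcOnClass_isIsogenous_powSucc_fourfold_octicCM_primeToThree :
    HCOnClass fun B ↦ ∃ (X : AbelianVariety ℂ) (N : ℕ) (K : Type) (_ : Field K) (_ : NumberField K)
      (_ : IsCMField K) (L : Type) (_ : Field L) (_ : NumberField L) (_ : IsCMField L) (_ : IsGalois ℚ L)
      (_ : K →ₐ[ℚ] L), Module.finrank ℚ K = 8 ∧ ¬ 3 ∣ Module.finrank ℚ L ∧ Module.finrank ℚ K = 2 * X.dim ∧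
      Nonempty (K →+* X.endAlgebra) ∧ IsIsogenous B (X.powSucc N) := by
  rintro B ⟨X, N, K, _, _, _, L, _, _, _, _, j, h8, h3, hX, ⟨φ⟩, h⟩
  exact (isStablyNondegenerate_octic_of_embedding h8 j h3 φ hX).hodgeConjectureFor_of_isIsogenous_powSucc h

end Summit.HodgeConjecture.CorCM.OcticPrimeToThreeAllTypes

end
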